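import Mathlib
import Summits.Ventures.PercRepro2.Defs
import Summits.Ventures.PercRepro2.Independence
import Summits.Ventures.PercRepro2.Harris
import Summits.Ventures.PercRepro2.Graph
import Summits.Ventures.PercRepro2.Exploration
import Summits.Ventures.PercRepro2.Events
import Summits.Ventures.PercRepro2.FourFunctions
import Summits.Ventures.PercRepro2.Induced
import Summits.Ventures.PercRepro2.Frontier
import Summits.Ventures.PercRepro2.ObsIndependence
import Summits.Ventures.PercRepro2.BHK
import Summits.Ventures.PercRepro2.BHKEvents
import Summits.Ventures.PercRepro2.VdBKahn
import Summits.Ventures.PercRepro2.BHKAvoid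
import Summits.Ventures.PercRepro2.OrderPreservation
import Summits.Ventures.PercRepro2.OrderPreservationQuant
import Summits.Ventures.PercRepro2.HF2

/-!
# (Yu2) from HF2 — the heavy-first exploration (blind cell PercRepro2, p1)

Roots `o, b, l` (light), `h` (heavy), `t` (third root), labelling `P(l ↔ b) ≤ P(h ↔ b)`;
`R′ = {h ↮ l, h ↮ t}`, `PD = R′ ∩ {t ↮ l}`, `T = {h ↮ l, h ↔ t}`, `M_h = P(PD, h ↔ b)`,
`Δ_T = P(h ↔ b, T) − P(l ↔ b, T)`, `N_l = P(l ↔ b, R′)`, `T_{h→l} = P(PD, o ∈ C_h, b ∈ C_l)`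
(`proofs/LEAD-PROOFSHAPES.md` §8.9 ADDENDUM 10 (10d); `proofs/P1-HF2.md` §4).

Explore the heavy cluster `S = C_h` first. Conditionally on `S` (with `l, t ∉ S`) the rest is
percolation on `G ∖ S`, so with `q′(S) = P_{G∖S}(b ∈ C_l, t ∉ C_l)`, `z′(S) = P_{G∖S}(b ∈ C_l)`,
`u′(S) = P_{G∖S}(l ∉ C_t)` (all `delClusterProb`s):

* `T_{h→l} = E[1{o ∈ S} q′(S); R′]`, `P(PD, o ∈ C_h) = E[1{o ∈ S} u′(S); R′]`, `N_l = E[z′(S); R′]`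
  (tower identity `prob_clusterIn_inter_avoid_eq_expect`);
* `yu2_harris_del`: Harris in `G ∖ S` gives `q′ ≤ z′ · u′` pointwise;
* `yu2_bhk`: the functional BHK (`bhk_induced`, `X = Y = {l, t}`) with `F₁ = 1{o ∈ ·} · u′`
  (increasing) and `F₂ = 1 − z′` (increasing) gives
  `E[1_o u′ z′; R′] · P(R′) ≤ E[1_o u′; R′] · E[z′; R′] = P(PD, o ∈ C_h) · N_l`;
* `yu2_cross`: hence `T_{h→l} · P(R′) ≤ P(PD, o ∈ C_h) · N_l` (hypothesis-free cross-PD bound);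
* `yu2_of_hf2`: **(Yu2)** `T_{h→l} · P(PD) ≤ P(PD, o ∈ C_h) · (M_h + Δ_T)` under the labelling,
  by `hf2`.
-/

namespace Summit.Ventures.PercRepro2

section Yu2

variable {V : Type*} {E : Type*} [Fintype E] [DecidableEq E] [Fintype V] [DecidableEq V]
  {R : Type*} [Field R] [LinearOrder R] [IsStrictOrderedRing R]

omit [Fintype E] [DecidableEq E] [Fintype V] [DecidableEq V] in
/-- `delConfig` is monotone in the configuration. -/
lemma yu2_delConfig_mono (ends : E → Sym2 V) (W : Set V) {ω ω' : Config E} (h : ω ≤ ω') :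
    delConfig ends W ω ≤ delConfig ends W ω' := by
  intro e
  by_cases he : e ∈ touches ends W
  · simp [delConfig_apply_of_mem he]
  · rw [delConfig_apply_of_notMem he, delConfig_apply_of_notMem he]
    exact h e

omit [Fintype V] [DecidableEq V] in
/-- **Harris in `G ∖ W`**: `P_{G∖W}(b ∈ C_l, t ∉ C_l) ≤ P_{G∖W}(b ∈ C_l) · P_{G∖W}(l ∉ C_t)`. -/
lemma yu2_harris_del (p : E → R) (hp : IsProbVec p) (ends : E → Sym2 V) (l t b : V)
    (W : Set V) :
    delClusterProb p ends l {S | b ∈ S ∧ t ∉ S} W ≤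
      delClusterProb p ends l {S | b ∈ S} W * delClusterProb p ends t {S | l ∉ S} W := by
  unfold delClusterProb
  have hA : IsUpperSet {ω : Config E | cluster ends (delConfig ends W ω) l ∈ {S | b ∈ S}} := by
    intro ω ω' h hω
    simp only [Set.mem_setOf_eq, mem_cluster] at hω ⊢
    exact conn_mono (yu2_delConfig_mono ends W h) hω
  have hB : IsLowerSet {ω : Config E | cluster ends (delConfig ends W ω) t ∈ {S | l ∉ S}} := by
    intro ω ω' h hω
    simp only [Set.mem_setOf_eq, mem_cluster] at hω ⊢
    exact fun hc => hω (conn_mono (yu2_delConfig_mono ends W h) hc)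
  have e : {ω : Config E | cluster ends (delConfig ends W ω) l ∈ {S | b ∈ S ∧ t ∉ S}} =
      {ω : Config E | cluster ends (delConfig ends W ω) t ∈ {S | l ∉ S}} ∩
        {ω : Config E | cluster ends (delConfig ends W ω) l ∈ {S | b ∈ S}} := by
    ext ω
    simp only [Set.mem_setOf_eq, mem_cluster, Set.mem_inter_iff]
    exact ⟨fun ⟨h1, h2⟩ => ⟨fun h => h2 (conn_symm h), h1⟩,
      fun ⟨h1, h2⟩ => ⟨h2, fun h => h1 (conn_symm h)⟩⟩
  rw [e, mul_comm]
  exact prob_inter_le_prob_mul_prob_of_isLowerSet hp hB hA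

omit [Fintype V] [DecidableEq V] [LinearOrder R] [IsStrictOrderedRing R] in
/-- `P_{G∖W}(l ∉ C_t) = 1 − P_{G∖W}(l ∈ C_t)`. -/
lemma yu2_delClusterProb_compl (p : E → R) (ends : E → Sym2 V) (t l : V) (W : Set V) :
    delClusterProb p ends t {S | l ∉ S} W = 1 - delClusterProb p ends t {S | l ∈ S} W := by
  have := prob_compl p {ω : Config E | cluster ends (delConfig ends W ω) t ∈ {S | l ∈ S}}
  unfold delClusterProb
  convert this using 2
  ext ω
  simp

omit [Fintype V] [DecidableEq V] in
/-- `u′(W) = P_{G∖W}(l ∉ C_t)` is monotone in `W`. -/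
lemma yu2_u_mono (p : E → R) (hp : IsProbVec p) (ends : E → Sym2 V) (t l : V) :
    Monotone (delClusterProb p ends t {S | l ∉ S}) := by
  intro W W' h
  rw [yu2_delClusterProb_compl, yu2_delClusterProb_compl]
  have := delClusterProb_anti p hp ends t (isUpperSet_mem_setOf l) h
  linarith

/-- **The functional BHK step of (Yu2)** (`bhk_induced`, `s = h`, `X = Y = {l, t}`,
`F₁ = 1{o ∈ ·} · u′`, `F₂ = 1 − z′`):
`E[1{o ∈ C_h} u′(C_h) z′(C_h); R′] · P(R′) ≤ E[1{o ∈ C_h} u′(C_h); R′] · E[z′(C_h); R′]`. -/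
theorem yu2_bhk (p : E → R) (hp : IsProbVec p) (ends : E → Sym2 V) (o l h t b : V) :
    expect p (fun ω => {S : Set V | o ∈ S}.indicator 1 (cluster ends ω h) *
          delClusterProb p ends t {S | l ∉ S} (cluster ends ω h) *
          delClusterProb p ends l {S | b ∈ S} (cluster ends ω h) *
          (avoidAll ends h {l, t}).indicator 1 ω) *
        prob p (avoidAll ends h {l, t}) ≤
      expect p (fun ω => {S : Set V | o ∈ S}.indicator 1 (cluster ends ω h) *
          delClusterProb p ends t {S | l ∉ S} (cluster ends ω h) *
          (avoidAll ends h {l, t}).indicator 1 ω) *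
        expect p (fun ω => delClusterProb p ends l {S | b ∈ S} (cluster ends ω h) *
          (avoidAll ends h {l, t}).indicator 1 ω) := by
  classical
  set u := delClusterProb p ends t {S : Set V | l ∉ S} with hu
  set z := delClusterProb p ends l {S : Set V | b ∈ S} with hz
  set F₁ : Set V → R := fun S => {S : Set V | o ∈ S}.indicator 1 S * u S with hF₁def
  set F₂ : Set V → R := fun S => 1 - z S with hF₂def
  have hF₁ : Monotone F₁ :=
    Monotone.mul (monotone_indicator_one_of_isUpperSet (isUpperSet_mem_setOf o))
      (yu2_u_mono p hp ends t l) (fun S => Set.indicator_apply_nonneg fun _ => zero_le_one)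
      (fun S => delClusterProb_nonneg p hp ends t _ S)
  have hF₂ : Monotone F₂ := fun S S' hSS' => by
    simp only [hF₂def]
    linarith [delClusterProb_anti p hp ends l (isUpperSet_mem_setOf b) hSS']
  have hF₁0 : ∀ S, 0 ≤ F₁ S := fun S =>
    mul_nonneg (Set.indicator_apply_nonneg fun _ => zero_le_one)
      (delClusterProb_nonneg p hp ends t _ S)
  have hF₂0 : ∀ S, 0 ≤ F₂ S := fun S => by
    simp only [hF₂def]
    linarith [delClusterProb_le_one p hp ends l {S : Set V | b ∈ S} S]
  have key := bhk_induced p hp ends h hF₁ hF₂ hF₁0 hF₂0 Finset.univ {l, t} {l, t}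
    (Finset.subset_univ _) (Finset.subset_univ _)
  simp only [Finset.inter_self, Finset.union_self, REvent_univ] at key
  have e : ∀ F : Set V → R, clusterObs ends Finset.univ h F * (avoidAll ends h {l, t}).indicator 1 =
      fun ω => F (cluster ends ω h) * (avoidAll ends h {l, t}).indicator 1 ω := by
    intro F
    funext ω
    simp only [Pi.mul_apply, clusterObs_apply, clusterIn_univ]
  rw [e, e, e] at key
  simp only [Pi.mul_apply, hF₁def, hF₂def] at key
  -- expand the `F₂`-expectations
  have eR : prob p (avoidAll ends h {l, t}) =
      expect p fun ω => (avoidAll ends h {l, t}).indicator 1 ω := prob_eq_expect_indicator p _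
  have e2 : expect p (fun ω => (1 - z (cluster ends ω h)) * (avoidAll ends h {l, t}).indicator 1 ω) =
      prob p (avoidAll ends h {l, t}) -
        expect p (fun ω => z (cluster ends ω h) * (avoidAll ends h {l, t}).indicator 1 ω) := by
    rw [eR, ← expect_sub]
    congr 1
    funext ω
    simp only [Pi.sub_apply]
    ring
  have e3 : expect p (fun ω => {S : Set V | o ∈ S}.indicator 1 (cluster ends ω h) *
        u (cluster ends ω h) * (1 - z (cluster ends ω h)) *
        (avoidAll ends h {l, t}).indicator 1 ω) =
      expect p (fun ω => {S : Set V | o ∈ S}.indicator 1 (cluster ends ω h) *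
          u (cluster ends ω h) * (avoidAll ends h {l, t}).indicator 1 ω) -
        expect p (fun ω => {S : Set V | o ∈ S}.indicator 1 (cluster ends ω h) *
          u (cluster ends ω h) * z (cluster ends ω h) *
          (avoidAll ends h {l, t}).indicator 1 ω) := by
    rw [← expect_sub]
    congr 1
    funext ω
    simp only [Pi.sub_apply]
    ring
  rw [e2, e3] at key
  nlinarith [key]

/-- **Cross-PD bound, `h → l`** (hypothesis-free): with `R′ = {h ↮ l, h ↮ t}`,
`PD = R′ ∩ {t ↮ l}`: `P(PD, o ∈ C_h, b ∈ C_l) · P(R′) ≤ P(PD, o ∈ C_h) · P(l ↔ b, R′)`.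
(Heavy-first exploration: tower identities, Harris in `G ∖ C_h`, functional BHK.) -/
theorem yu2_cross (p : E → R) (hp : IsProbVec p) (ends : E → Sym2 V) (o l h t b : V) :
    prob p ((connEvent ends h l)ᶜ ∩ (connEvent ends h t)ᶜ ∩ (connEvent ends t l)ᶜ ∩
          connEvent ends h o ∩ connEvent ends l b) *
        prob p ((connEvent ends h l)ᶜ ∩ (connEvent ends h t)ᶜ) ≤
      prob p ((connEvent ends h l)ᶜ ∩ (connEvent ends h t)ᶜ ∩ (connEvent ends t l)ᶜ ∩
          connEvent ends h o) *
        prob p (connEvent ends l b ∩ ((connEvent ends h l)ᶜ ∩ (connEvent ends h t)ᶜ)) := by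
  classical
  have hR := hf2_avoidAll_pair ends h l t
  -- the three tower identities
  have t1 := prob_clusterIn_inter_avoid_eq_expect p ends h l
    (show l ∈ ({l, t} : Finset V) by simp) {S : Set V | o ∈ S} {S : Set V | b ∈ S ∧ t ∉ S}
  have t2 := prob_clusterIn_inter_avoid_eq_expect p ends h t
    (show t ∈ ({l, t} : Finset V) by simp) {S : Set V | o ∈ S} {S : Set V | l ∉ S}
  have t3 := prob_clusterIn_inter_avoid_eq_expect p ends h l
    (show l ∈ ({l, t} : Finset V) by simp) Set.univ {S : Set V | b ∈ S}
  simp only [Set.indicator_univ, Pi.one_apply, one_mul] at t3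
  have e1 : clusterInEvent ends h {S : Set V | o ∈ S} ∩
      clusterInEvent ends l {S : Set V | b ∈ S ∧ t ∉ S} ∩ avoidAll ends h {l, t} =
      (connEvent ends h l)ᶜ ∩ (connEvent ends h t)ᶜ ∩ (connEvent ends t l)ᶜ ∩
        connEvent ends h o ∩ connEvent ends l b := by
    rw [hR]
    ext ω
    simp only [Set.mem_inter_iff, mem_clusterInEvent, Set.mem_setOf_eq, mem_cluster,
      Set.mem_compl_iff, mem_connEvent]
    exact ⟨fun ⟨⟨h1, h2, h3⟩, h4, h5⟩ => ⟨⟨⟨⟨h4, h5⟩, fun h => h3 (conn_symm h)⟩, h1⟩, h2⟩,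
      fun ⟨⟨⟨⟨h4, h5⟩, h3⟩, h1⟩, h2⟩ => ⟨⟨h1, h2, fun h => h3 (conn_symm h)⟩, h4, h5⟩⟩
  have e2 : clusterInEvent ends h {S : Set V | o ∈ S} ∩
      clusterInEvent ends t {S : Set V | l ∉ S} ∩ avoidAll ends h {l, t} =
      (connEvent ends h l)ᶜ ∩ (connEvent ends h t)ᶜ ∩ (connEvent ends t l)ᶜ ∩
        connEvent ends h o := by
    rw [hR]
    ext ω
    simp only [Set.mem_inter_iff, mem_clusterInEvent, Set.mem_setOf_eq, mem_cluster,
      Set.mem_compl_iff, mem_connEvent]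
    exact ⟨fun ⟨⟨h1, h3⟩, h4, h5⟩ => ⟨⟨⟨h4, h5⟩, h3⟩, h1⟩,
      fun ⟨⟨⟨h4, h5⟩, h3⟩, h1⟩ => ⟨⟨h1, h3⟩, h4, h5⟩⟩
  have e3 : clusterInEvent ends h Set.univ ∩ clusterInEvent ends l {S : Set V | b ∈ S} ∩
      avoidAll ends h {l, t} =
      connEvent ends l b ∩ ((connEvent ends h l)ᶜ ∩ (connEvent ends h t)ᶜ) := by
    rw [hR]
    ext ω
    simp only [Set.mem_inter_iff, mem_clusterInEvent, Set.mem_setOf_eq, mem_cluster,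
      Set.mem_compl_iff, mem_connEvent, Set.mem_univ, true_and]
  rw [e1] at t1
  rw [e2] at t2
  rw [e3] at t3
  rw [t1, t2, t3, ← hR]
  -- pointwise Harris in `G ∖ C_h`
  have hpt : ∀ ω, {S : Set V | o ∈ S}.indicator 1 (cluster ends ω h) *
        delClusterProb p ends l {S : Set V | b ∈ S ∧ t ∉ S} (cluster ends ω h) *
        (avoidAll ends h {l, t}).indicator 1 ω ≤
      {S : Set V | o ∈ S}.indicator 1 (cluster ends ω h) *
        delClusterProb p ends t {S : Set V | l ∉ S} (cluster ends ω h) *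
        delClusterProb p ends l {S : Set V | b ∈ S} (cluster ends ω h) *
        (avoidAll ends h {l, t}).indicator 1 ω := by
    intro ω
    have h0 : (0 : R) ≤ {S : Set V | o ∈ S}.indicator 1 (cluster ends ω h) :=
      Set.indicator_apply_nonneg fun _ => zero_le_one
    have h1 : (0 : R) ≤ (avoidAll ends h {l, t}).indicator 1 ω :=
      Set.indicator_apply_nonneg fun _ => zero_le_one
    have hq := yu2_harris_del p hp ends l t b (cluster ends ω h)
    calc {S : Set V | o ∈ S}.indicator 1 (cluster ends ω h) *
          delClusterProb p ends l {S : Set V | b ∈ S ∧ t ∉ S} (cluster ends ω h) *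
          (avoidAll ends h {l, t}).indicator 1 ω ≤
        {S : Set V | o ∈ S}.indicator 1 (cluster ends ω h) *
          (delClusterProb p ends l {S : Set V | b ∈ S} (cluster ends ω h) *
            delClusterProb p ends t {S : Set V | l ∉ S} (cluster ends ω h)) *
          (avoidAll ends h {l, t}).indicator 1 ω :=
          mul_le_mul_of_nonneg_right (mul_le_mul_of_nonneg_left hq h0) h1
      _ = _ := by ring
  have hmono := expect_mono hp hpt
  have hbhk := yu2_bhk p hp ends o l h t b
  have hR0 : 0 ≤ prob p (avoidAll ends h {l, t}) := prob_nonneg hp _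
  calc expect p (fun ω => {S : Set V | o ∈ S}.indicator 1 (cluster ends ω h) *
          delClusterProb p ends l {S : Set V | b ∈ S ∧ t ∉ S} (cluster ends ω h) *
          (avoidAll ends h {l, t}).indicator 1 ω) * prob p (avoidAll ends h {l, t}) ≤
      expect p (fun ω => {S : Set V | o ∈ S}.indicator 1 (cluster ends ω h) *
          delClusterProb p ends t {S : Set V | l ∉ S} (cluster ends ω h) *
          delClusterProb p ends l {S : Set V | b ∈ S} (cluster ends ω h) *
          (avoidAll ends h {l, t}).indicator 1 ω) * prob p (avoidAll ends h {l, t}) :=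
        mul_le_mul_of_nonneg_right hmono hR0
    _ ≤ _ := hbhk

/-- **(Yu2)** (the second piece of the (Y) skeleton, ADDENDUM 10 (10)): under the labelling
`P(l ↔ b) ≤ P(h ↔ b)`, with `R′ = {h ↮ l, h ↮ t}`, `PD = R′ ∩ {t ↮ l}`, `T = {h ↮ l, h ↔ t}`,
`M_h = P(PD, h ↔ b)`, `Δ_T = P(h ↔ b, T) − P(l ↔ b, T)`:
`P(PD, o ∈ C_h, b ∈ C_l) · P(PD) ≤ P(PD, o ∈ C_h) · (M_h + Δ_T)`. -/
theorem yu2_of_hf2 (p : E → R) (hp : IsProbVec p) (ends : E → Sym2 V) (o l h t b : V)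
    (hlab : prob p (connEvent ends l b) ≤ prob p (connEvent ends h b)) :
    prob p ((connEvent ends h l)ᶜ ∩ (connEvent ends h t)ᶜ ∩ (connEvent ends t l)ᶜ ∩
          connEvent ends h o ∩ connEvent ends l b) *
        prob p ((connEvent ends h l)ᶜ ∩ (connEvent ends h t)ᶜ ∩ (connEvent ends t l)ᶜ) ≤
      prob p ((connEvent ends h l)ᶜ ∩ (connEvent ends h t)ᶜ ∩ (connEvent ends t l)ᶜ ∩
          connEvent ends h o) *
        (prob p ((connEvent ends h l)ᶜ ∩ (connEvent ends h t)ᶜ ∩ (connEvent ends t l)ᶜ ∩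
            connEvent ends h b) +
          (prob p (connEvent ends h b ∩ ((connEvent ends h l)ᶜ ∩ connEvent ends h t)) -
            prob p (connEvent ends l b ∩ ((connEvent ends h l)ᶜ ∩ connEvent ends h t)))) := by
  have hc := yu2_cross p hp ends o l h t b
  have hh := hf2 p hp ends h l t b hlab
  set Rp : Set (Config E) := (connEvent ends h l)ᶜ ∩ (connEvent ends h t)ᶜ with hRp
  have hPPD0 : 0 ≤ prob p (Rp ∩ (connEvent ends t l)ᶜ) := prob_nonneg hp _
  have hPDo0 : 0 ≤ prob p (Rp ∩ (connEvent ends t l)ᶜ ∩ connEvent ends h o) := prob_nonneg hp _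
  rcases (prob_nonneg hp Rp).lt_or_eq with hpos | hzero
  · refine le_of_mul_le_mul_right ?_ hpos
    calc prob p (Rp ∩ (connEvent ends t l)ᶜ ∩ connEvent ends h o ∩ connEvent ends l b) *
          prob p (Rp ∩ (connEvent ends t l)ᶜ) * prob p Rp =
        prob p (Rp ∩ (connEvent ends t l)ᶜ ∩ connEvent ends h o ∩ connEvent ends l b) *
          prob p Rp * prob p (Rp ∩ (connEvent ends t l)ᶜ) := by ring
      _ ≤ prob p (Rp ∩ (connEvent ends t l)ᶜ ∩ connEvent ends h o) * prob p (connEvent ends l b ∩ Rp) *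
          prob p (Rp ∩ (connEvent ends t l)ᶜ) := mul_le_mul_of_nonneg_right hc hPPD0
      _ = prob p (Rp ∩ (connEvent ends t l)ᶜ ∩ connEvent ends h o) *
          (prob p (connEvent ends l b ∩ Rp) * prob p (Rp ∩ (connEvent ends t l)ᶜ)) := by ring
      _ ≤ prob p (Rp ∩ (connEvent ends t l)ᶜ ∩ connEvent ends h o) *
          ((prob p (Rp ∩ (connEvent ends t l)ᶜ ∩ connEvent ends h b) +
            (prob p (connEvent ends h b ∩ ((connEvent ends h l)ᶜ ∩ connEvent ends h t)) -
              prob p (connEvent ends l b ∩ ((connEvent ends h l)ᶜ ∩ connEvent ends h t)))) *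
            prob p Rp) := mul_le_mul_of_nonneg_left hh hPDo0
      _ = _ := by ring
  · -- `P(R′) = 0`: both sides vanish
    have hPPD : prob p (Rp ∩ (connEvent ends t l)ᶜ) = 0 :=
      le_antisymm (hzero ▸ prob_mono hp Set.inter_subset_left) hPPD0
    have hPDo : prob p (Rp ∩ (connEvent ends t l)ᶜ ∩ connEvent ends h o) = 0 :=
      le_antisymm (hzero ▸ prob_mono hp (Set.inter_subset_left.trans Set.inter_subset_left)) hPDo0
    rw [hPPD, hPDo]
    simp

end Yu2

end Summit.Ventures.PercRepro2
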